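import Summits.QuantumAdvantage.QuantumAdvantage.Theses.SosSandwich
import Literature.Computability.QuantumComplexity.PseudoBounded

/-!
# Route `SosSandwich`: support item `PseudoBoundedRestrict` (stmt-QuantumAdvantage-15243)

`K_T` (pseudo-bounded of order `T`: `p` and `1 - p` are sums of squares of polynomials of total degree
`≤ T` as functions on the cube) is closed under the Boolean restriction `xᵢ := b` rendered as
`MvPolynomial.bind₁ (fun j => if j = i then C b else X j)`: substitute into the `q_j, r_j` (an affine
substitution does not raise total degrees) and note that on the cube the restricted polynomials evaluate
at the updated point. The item's inline `let ev := …` hypothesis is definitionally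
`Literature.Computability.QuantumComplexity.PseudoBounded T p` (`pseudoBounded_iff` is `Iff.rfl`), whose
closure lemma `PseudoBounded.restrict` (fact-free module `PseudoBounded.lean`) is exactly the claim.
-/

set_option linter.dupNamespace false -- D-0017: single-problem summit ⇒ `QuantumAdvantage.QuantumAdvantage` by design

namespace Summit.QuantumAdvantage.QuantumAdvantage.Theorems.SosSandwich

open Literature.Computability.QuantumComplexity in
/-- **`SosSandwich.PseudoBoundedRestrict`** (stmt-QuantumAdvantage-15243): the SOS sandwich class `K_T` is
closed under restricting one variable to a Boolean constant (`bind₁`, dummy variable kept) — substitute into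
the degree-`≤ T` certificates `q_j, r_j`. [cite: AaronsonAmbainis2014, Thm. 3.3 (proof, restrictions
p|_{x_i := b})] [cite: KaniewskiLeeDewolf2015, Def. 7] -/
theorem PseudoBoundedRestrict_proof :
    Summit.QuantumAdvantage.QuantumAdvantage.Theses.SosSandwich.PseudoBoundedRestrict := by
  unfold Summit.QuantumAdvantage.QuantumAdvantage.Theses.SosSandwich.PseudoBoundedRestrict
  intro N T p i b ev h
  exact PseudoBounded.restrict (T := T) (p := p) h i b

end Summit.QuantumAdvantage.QuantumAdvantage.Theorems.SosSandwich
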